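import Summits.HodgeConjecture.Statement
import Summits.HodgeConjecture.HodgeConjecture.Theses.RankFourFaces
import Summits.HodgeConjecture.HodgeConjecture.Theses.PadicSemiregularLift
import Literature.AlgebraicGeometry.HodgeTheory.HodgeGroupProductCMFactor
import HarnessLib

/-!
# Ring 2 · route `motiv` — Hodge-for-CM through a CM FACTOR (Mumford–Tate / Hodge-ring generation)

HONEST FRAMING: research route conditional on HC_CM; not a corollary; Q11.4-sentence-2 already refuted in dim ≥ 3.

Cell `pub-hodge-ring2`, seat `pub-hodge-ring2-motiv`. This file is the SUMMIT-SIDE binding of the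
Literature file `Literature/AlgebraicGeometry/HodgeTheory/HodgeGroupProductCMFactor.lean` (p184787):
there the hypothesis "Hodge conjecture for CM abelian varieties" is the Milne-1999 form
`∀ B, Milne1999.CMHodgeHypothesisAt B`; here it is bound BY NAME to the tree's route item
`Theses.RankFourFaces.CMAbelianHodge` (stmt-HodgeConjecture-3052), which is that statement by `Iff.rfl`
(referee ruling, cell ref1 §1). `HC_CM` is a HYPOTHESIS (a binder) of every conditional theorem below —
never an axiom, never "known". The class target `HC_AV` is the tree item
`Theses.PadicSemiregularLift.HodgeAbelianVarieties` (stmt-HodgeConjecture-1333).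

## Content (all proofs are one-line compositions of the Literature theorems; sorry-free)

* `hodgeConjectureFor_prod_of_cmAbelianHodge` :
  `CMAbelianHodge → Lombardo2016_hodgeClassesProductSpan → (A has no simple factor of type IV) →
   (C of CM type) → HC(A) → HC(A × C)`.
  The ONLY place `HC_CM` is used is HC(C); the transport-free mechanism is the splitting
  `Hg(A × C) = Hg(A) × Hg(C)` (Lombardo 2016, Lemma 35 of arXiv:1402.1478 §3: "Suppose B is of CM type and
  A has no simple factor of type IV. Then H(A × B) ≅ H(A) × H(B)") read through Moonen–Zarhin 1999 §3
  ("Hg(X₁ × X₂) ≠ Hg(X₁) × Hg(X₂) holds iff for some m, n the Hodge ring B(X₁^m × X₂^n) is not generated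
  by the elements coming from B(X₁^m) and B(X₂^n)"), typed as the named fact
  `Lombardo2016_hodgeClassesProductSpan` (a theorem in print, a hypothesis in Lean).
* `…_of_dim_le_three` : the case `dim A ≤ 3` CLOSED with refereed inputs only (HC in dimension ≤ 3 is the
  tree theorem `hodgeConjectureFor_of_dim_le_three_holds`).
* `…_of_dim_le_five_of` : the case `dim A ≤ 5` on the Markman 2025 claim (Weil classes on abelian
  fourfolds are algebraic; UNREFEREED) [claim: Markman2025SurveySecant, status: under-review], entering
  as the named claim-fact `Markman2025_hodgeClasses_algebraic_abelian_dim_le_five` — a hypothesis.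
* ON-PATH lemmas: `hodgeConjectureFor_prod_of_hodgeConjecture` (the conclusion follows from the summit
  statement `_root_.HodgeConjecture`, literally) and `hodgeConjectureFor_prod_of_hodgeAbelianVarieties`
  (it is an instance of `HC_AV`), so no row of this route is off the path to the summit.

Which hypotheses survive the Q11.4 no-go: all of them — this route uses no transport, no deformation and
no semiregularity, so the refutation of Markman Q11.4 sentence 2 (dim ≥ 3) and the CM-density no-go do
not touch it. Its limitation is the converse one: it never produces a non-product Hodge class (the
non-split sector `A′ × C` with `A′` having a non-CM factor of type IV, and simple non-CM Weil type, are out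
of reach; cell RING2-MAP.md §motiv M-C).

References: Lombardo2016 (arXiv:1402.1478 §3 Lemma 35, Remark 46; Ann. Inst. Fourier 66 (2016));
MoonenZarhin1999LowDim (§3); Milne1999 (§7 (H)); Shioda1981FermatTypeAV; VoisinHodgeII2003 (Künneth,
cycle classes of products).
-/

set_option linter.dupNamespace false

namespace Summit.HodgeConjecture.HodgeConjecture.Ring2.Motiv

open Literature.AlgebraicGeometry Literature.AlgebraicGeometry.Motives
open Literature.AlgebraicGeometry.HodgeTheory
open Summit.HodgeConjecture.HodgeConjecture.Theses

/-- **HC(A × C) from Hodge-for-CM through the CM factor.** For complex abelian varieties `A`, `C` with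
`A` having no simple factor of type IV (`HasNoTypeIVFactor A`: every central endomorphism of `A` is killed
by a rational polynomial with only real roots) and `C` of CM type: `HC_CM` (tree item
`RankFourFaces.CMAbelianHodge`, a HYPOTHESIS), the printed splitting/generation fact
`Lombardo2016_hodgeClassesProductSpan` (Lombardo 2016 L35 ∘ Moonen–Zarhin 1999 §3, a HYPOTHESIS naming a
theorem in print) and HC for `A` give HC for the product abelian variety `A.prod C`. `HC_CM` is used
exactly once, for HC(C). [cite: Lombardo2016, §3 Lemma 35 (arXiv:1402.1478 numbering)]
[cite: MoonenZarhin1999LowDim, §3] -/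
theorem hodgeConjectureFor_prod_of_cmAbelianHodge
    (hCM : RankFourFaces.CMAbelianHodge) (hL : Lombardo2016_hodgeClassesProductSpan)
    (A C : AbelianVariety ℂ) (hA4 : HasNoTypeIVFactor A) (hCt : Milne1999.IsOfCMType C)
    (hA : HodgeConjectureFor A.dim A.X) :
    HodgeConjectureFor (A.prod C).dim (A.prod C).X :=
  hodgeConjectureFor_prod_of_cmHodgeHypothesis hCM hL A C hA4 hCt hA

/-- **Closed class, refereed inputs only: `dim A ≤ 3`.** `HC_CM` + the Lombardo/Moonen–Zarhin fact give
HC for `A.prod C` whenever `A` has no simple factor of type IV and dimension ≤ 3 and `C` is of CM type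
(any dimension); HC(A) is the tree theorem `hodgeConjectureFor_of_dim_le_three_holds` (Lefschetz (1,1) +
hard Lefschetz; Moonen–Zarhin 1999, Introduction: "If dim(X) ≤ 3 then every Hodge class on X is a linear
combination of products of divisor classes"). The ring-2 content sits where `C` is a CM abelian variety
of dimension ≥ 4 with exceptional Hodge classes. [cite: Lombardo2016, §3 Lemma 35]
[cite: MoonenZarhin1999LowDim, Introduction and §3] -/
theorem hodgeConjectureFor_prod_of_cmAbelianHodge_of_dim_le_three
    (hCM : RankFourFaces.CMAbelianHodge) (hL : Lombardo2016_hodgeClassesProductSpan)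
    (A C : AbelianVariety ℂ) (hA4 : HasNoTypeIVFactor A) (hCt : Milne1999.IsOfCMType C)
    (hd : A.dim ≤ 3) :
    HodgeConjectureFor (A.prod C).dim (A.prod C).X :=
  hodgeConjectureFor_prod_of_cmHodgeHypothesis_of_dim_le_three hCM hL A C hd hA4 hCt

/-- **`dim A ≤ 5`, on the Markman claim.** As above with `dim A ≤ 5`, using additionally the named
claim-fact `Markman2025_hodgeClasses_algebraic_abelian_dim_le_five` (Markman 2025: Weil classes on
abelian fourfolds are algebraic, hence — with Moonen–Zarhin 1999 — HC for abelian varieties of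
dimension ≤ 5; UNREFEREED) — a HYPOTHESIS. [claim: Markman2025SurveySecant, status: under-review]
[cite: MoonenZarhin1999LowDim, main theorem] [cite: Lombardo2016, §3 Lemma 35] -/
theorem hodgeConjectureFor_prod_of_cmAbelianHodge_of_dim_le_five_of
    (hCM : RankFourFaces.CMAbelianHodge) (hL : Lombardo2016_hodgeClassesProductSpan)
    (hM : Markman2025_hodgeClasses_algebraic_abelian_dim_le_five)
    (A C : AbelianVariety ℂ) (hA4 : HasNoTypeIVFactor A) (hCt : Milne1999.IsOfCMType C)
    (hd : A.dim ≤ 5) :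
    HodgeConjectureFor (A.prod C).dim (A.prod C).X :=
  hodgeConjectureFor_prod_of_cmHodgeHypothesis_of_dim_le_five_of hM hCM hL A C hd hA4 hCt

/-! ## On-path lemmas: every conclusion above is a consequence of the summit statement -/

/-- ON-PATH: the summit statement `HodgeConjecture` gives the conclusion of
`hodgeConjectureFor_prod_of_cmAbelianHodge` outright (products of abelian varieties are smooth
projective), so the conditional theorem is a genuine special case of the summit, not a detour. [folklore] -/
theorem hodgeConjectureFor_prod_of_hodgeConjecture (h : _root_.HodgeConjecture)
    (A C : AbelianVariety ℂ) : HodgeConjectureFor (A.prod C).dim (A.prod C).X :=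
  HodgeTheory.hodgeConjectureFor_prod_of_hodgeConjecture h A C

/-- ON-PATH: the conclusion is an instance of `HC_AV` (tree item
`PadicSemiregularLift.HodgeAbelianVarieties`). [folklore] -/
theorem hodgeConjectureFor_prod_of_hodgeAbelianVarieties
    (hAV : PadicSemiregularLift.HodgeAbelianVarieties) (A C : AbelianVariety ℂ) :
    HodgeConjectureFor (A.prod C).dim (A.prod C).X :=
  hAV (A.prod C)

/-- ON-PATH: the summit statement gives `HC_CM` itself (forget the CM hypothesis), so the hypothesis
`hCM` of the conditional theorems is also on the path. [folklore] -/
theorem cmAbelianHodge_of_hodgeConjecture (h : _root_.HodgeConjecture) :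
    RankFourFaces.CMAbelianHodge :=
  fun A _ _ => h (AbelianVariety.isSmoothProjective_holds (A := A))

end Summit.HodgeConjecture.HodgeConjecture.Ring2.Motiv
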